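import Summits.HodgeConjecture.HodgeConjecture.Theses.HeckePrymWeil
import Literature.AlgebraicGeometry.HodgeTheory.WeilClassesCyclicPrymDegreeSeven
import Literature.AlgebraicGeometry.Motives.PrymVariety
import Literature.AlgebraicGeometry.Motives.Jacobian
import HarnessLib

/-!
# Crux `WeilTwelvefoldsSqrtMinus7` (stmt-HodgeConjecture-1261), line `isotypic-unimodular-saturation` — stub `stub_schoenLines`

**Schoen's isotypic lines on the Prym of a cyclic étale cover of prime degree `7`** (Stub 1 of the
line; C. Schoen, Compositio Math. 65 (1988), Cor. 3.1 with Thm. 2.0 and Lemma 1.5 at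
`(q, m, r) = (7, 7, 0)` = D. Patel–Y. Zhang, arXiv:2506.13729 (2025), Thm. 1.2 / Thm. 5.3 with
Lemma 5.1 at `G = ℤ/7`, `g(C') = 7`, `h = 12`).  The registered stub is a PUBLISHED THEOREM whose
proof (symmetric powers, the Abel–Jacobi `ℙ⁶`-bundle, the geometric class-field-theory square,
Lieberman) is not in the tree; it is vendored as the Literature named fact
`Literature.AlgebraicGeometry.HodgeTheory.Schoen1988_cyclicPrym_weilClasses_algebraic_degreeSeven`
(`WeilClassesCyclicPrymDegreeSeven.lean`, the degree-`7` sibling of `…_degreeSix` / `…_degreeThree`),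
whose statement IS the registered signature verbatim (single-operator typing
`Eig((2·𝟙_B + s_B)^*, (2 + ζ₇^a)¹²)`, certified exact by
`Negative.SchoenLinesTyping.twoAddZeta7_prod_eq_pow_iff`: `Φ₇(-2) = 43` is prime).  This file records

* `stub_schoenLines_of_schoen1988` — the REDUCTION: the named fact implies the registered signature
  (by `id`; the result is CONDITIONAL on the named fact, trust base = that one name);
* `stub_schoenLines_endomorphismDictionary` — the endomorphism half of the rendering at the stub's
  own binders, PROVED (from the dictionary lemmas of `WeilClassesCyclicPrymDegreeSeven`): every
  `σⁱ` (`1 ≤ i ≤ 6`) is fixed-point free (the cover `C → C/⟨σ⟩` is étale), `s⁷ = 𝟙`, `s` commutes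
  with `e_N` (so `s_B` exists), `(𝟙 - s) ≫ e_N = 0`, `e_N ≫ e_N = 7 e_N`, `Φ₇(s_B) = 0`, `s_B⁷ = 𝟙`,
  and the Gauss sum `η_B = s_B + s_B² + s_B⁴ - s_B³ - s_B⁵ - s_B⁶` has `η_B ≫ η_B = -7` — the
  `√-7 ∈ ℤ[ζ₇] ⊂ End B` that the neighbouring stub `stub_heckePrymWeilPlane` restricts to the
  Hecke–Prym twelvefold.
-/

noncomputable section

set_option linter.dupNamespace false

open CategoryTheory
open Literature.AlgebraicGeometry Literature.AlgebraicGeometry.Motives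
  Literature.AlgebraicGeometry.HodgeTheory Literature.AlgebraicTopology.SingularHomology

namespace Summit.HodgeConjecture.HodgeConjecture.Theorems.WeilTwelvefoldsSqrtMinus7.IsotypicUnimodularSaturation

/-- **Stub `stub_schoenLines` (Stub 1) of line `isotypic-unimodular-saturation`, crux
`WeilTwelvefoldsSqrtMinus7` (stmt-HodgeConjecture-1261), from Schoen's theorem.**  For a smooth
projective complex curve `C` with a fixed-point-free automorphism `σ` of order `7` and a Jacobian `𝒥`
of dimension `43` (`C → C/⟨σ⟩` étale cyclic of degree `7` over a genus-`7` curve, `h = 12`),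
`s = σ_*`, `e_N = Σ_{i<7} sⁱ`, `B = (ker e_N)⁰` (dim `36`) with a restriction `s_B` of `s`: for
`1 ≤ a ≤ 6` every class of `Eig((2·𝟙_B + s_B)^*, (2 + ζ₇^a)¹²) ⊆ H¹²(B(ℂ); ℂ)` — which is EXACTLY
the Schoen / Patel–Zhang line `⋀¹² H¹(B)_{ζ₇^a} ⊂ U_Weil ⊗ ℂ` (`Φ₇(-2) = 43` prime:
`Negative.SchoenLinesTyping.twoAddZeta7_prod_eq_pow_iff`) — is algebraic.  This is the registered
signature of `stub_schoenLines`, and it is literally the Literature named fact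
`Schoen1988_cyclicPrym_weilClasses_algebraic_degreeSeven` (Schoen 1988, Cor. 3.1 with Thm. 2.0 at
`(q, m, r) = (7, 7, 0)`; Patel–Zhang 2025, Thm. 1.2 / Thm. 5.3): the stub holds CONDITIONALLY on
that fact, by `id`. [cite: Schoen1988HodgeWeil, Cor 3.1 (p. 24) with Thm 2.0 (p. 11)]
[cite: PatelZhang2025PrymHodge, Thm 1.2, Lemma 5.1 and Thm 5.3] -/
theorem stub_schoenLines_of_schoen1988 :
    Schoen1988_cyclicPrym_weilClasses_algebraic_degreeSeven →
    ∀ (C : SchemeOver ℂ) (𝒥 : Jacobian C) (σ : C ⟶ C),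
      IsSmoothProjective 1 C → 𝒥.J.dim = 43 →
      σ ≫ σ ≫ σ ≫ σ ≫ σ ≫ σ ≫ σ = 𝟙 C → (∀ P : ComplexPoints C, P ≫ σ ≠ P) →
    ∀ (s eN : 𝒥.J ⟶ 𝒥.J), s = 𝒥.pushforward 𝒥 σ →
      eN = 𝟙 𝒥.J + s + s ≫ s + s ≫ s ≫ s + s ≫ s ≫ s ≫ s + s ≫ s ≫ s ≫ s ≫ s +
        s ≫ s ≫ s ≫ s ≫ s ≫ s →
    ∀ (sB : AbelianVariety.kerComponent eN ⟶ AbelianVariety.kerComponent eN),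
      sB ≫ AbelianVariety.kerComponentι eN = AbelianVariety.kerComponentι eN ≫ s →
    ∀ a : ℕ, 1 ≤ a → a ≤ 6 →
    ∀ c : complexBetti (AbelianVariety.kerComponent eN).X 12,
      c ∈ Module.End.eigenspace
          (complexBetti.map ((2 : ℤ) • 𝟙 (AbelianVariety.kerComponent eN) + sB).hom.hom.hom 12).hom
          ((2 + Complex.exp (2 * (Real.pi : ℂ) * Complex.I / 7) ^ a) ^ 12) →
      c ∈ algebraicClasses (AbelianVariety.kerComponent eN).X 6 :=
  fun h => h

/-- **The endomorphism dictionary of Stub 1 at its own binders (proved, unconditional).**  For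
`σ⁷ = 𝟙_C` fixed-point free on complex points, `s = σ_*`, `e_N = Σ_{i<7} sⁱ`, `B = (ker e_N)⁰` and
any restriction `s_B` (`s_B ≫ ι = ι ≫ s`): every `σⁱ`, `1 ≤ i ≤ 6`, is fixed-point free (prime
order: the `ℤ/7`-action is free, the cover `C → C/⟨σ⟩` is étale — `r = 0` in Schoen's Thm. 2.0);
`s⁷ = 𝟙` (Albanese functoriality); `s ≫ e_N = e_N ≫ s` (so `s_B` exists:
`AbelianVariety.kerComponentRestrict`), `(𝟙 - s) ≫ e_N = 0` (`Im(𝟙 - s) ⊆ ker e_N`, Patel–Zhang §5)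
and `e_N ≫ e_N = 7 e_N`; `Φ₇(s_B) = 0` (so `s_B` acts on every realisation through primitive 7th
roots of unity: `B = B_prim`, `ℤ[s_B] = ℤ[ζ₇]`), `s_B⁷ = 𝟙`; and the quadratic Gauss sum
`η_B = s_B + s_B² + s_B⁴ - s_B³ - s_B⁵ - s_B⁶` satisfies `η_B ≫ η_B = -7` (`ℚ(√-7) ⊂ ℚ(ζ₇)`; the
scalar shadow is `Negative.SchoenLinesTyping.gaussSum7_sq`).
[cite: Schoen1988HodgeWeil, §3 (p. 24)] [cite: PatelZhang2025PrymHodge, §5 (eqn. Prym) and Lemma 5.1] -/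
theorem stub_schoenLines_endomorphismDictionary :
    ∀ (C : SchemeOver ℂ) (𝒥 : Jacobian C) (σ : C ⟶ C),
      σ ≫ σ ≫ σ ≫ σ ≫ σ ≫ σ ≫ σ = 𝟙 C → (∀ P : ComplexPoints C, P ≫ σ ≠ P) →
    ∀ (s eN : 𝒥.J ⟶ 𝒥.J), s = 𝒥.pushforward 𝒥 σ →
      eN = 𝟙 𝒥.J + s + s ≫ s + s ≫ s ≫ s + s ≫ s ≫ s ≫ s + s ≫ s ≫ s ≫ s ≫ s +
        s ≫ s ≫ s ≫ s ≫ s ≫ s →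
    ∀ (sB : AbelianVariety.kerComponent eN ⟶ AbelianVariety.kerComponent eN),
      sB ≫ AbelianVariety.kerComponentι eN = AbelianVariety.kerComponentι eN ≫ s →
    (∀ P : ComplexPoints C,
      P ≫ σ ≫ σ ≠ P ∧ P ≫ σ ≫ σ ≫ σ ≠ P ∧ P ≫ σ ≫ σ ≫ σ ≫ σ ≠ P ∧
        P ≫ σ ≫ σ ≫ σ ≫ σ ≫ σ ≠ P ∧ P ≫ σ ≫ σ ≫ σ ≫ σ ≫ σ ≫ σ ≠ P) ∧
    s ≫ s ≫ s ≫ s ≫ s ≫ s ≫ s = 𝟙 𝒥.J ∧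
    (s ≫ eN = eN ≫ s ∧ (𝟙 𝒥.J - s) ≫ eN = 0 ∧ eN ≫ eN = 7 • eN) ∧
    𝟙 _ + sB + sB ≫ sB + sB ≫ sB ≫ sB + sB ≫ sB ≫ sB ≫ sB + sB ≫ sB ≫ sB ≫ sB ≫ sB +
      sB ≫ sB ≫ sB ≫ sB ≫ sB ≫ sB = 0 ∧
    sB ≫ sB ≫ sB ≫ sB ≫ sB ≫ sB ≫ sB = 𝟙 _ ∧
    ∀ η : AbelianVariety.kerComponent eN ⟶ AbelianVariety.kerComponent eN,
      η = sB + sB ≫ sB + sB ≫ sB ≫ sB ≫ sB - sB ≫ sB ≫ sB - sB ≫ sB ≫ sB ≫ sB ≫ sB -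
        sB ≫ sB ≫ sB ≫ sB ≫ sB ≫ sB →
      η ≫ η = -((7 : ℤ) • 𝟙 (AbelianVariety.kerComponent eN)) := by
  intro C 𝒥 σ hσ hfree s eN hs heN sB hsB
  exact ⟨complexPoints_comp_pow_ne_of_pow_seven hσ hfree,
    pushforward_comp_pow_seven_of_pow_seven 𝒥 hσ hs, pushforward_normElement 𝒥 hσ hs heN,
    kerComponent_cyclotomic₇_restrict_eq_zero heN hsB, kerComponent_restrict_comp_pow_seven heN hsB,
    fun η hη => kerComponent_weilOperator_comp_self_of_cyclotomic₇ heN hsB hη⟩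

end Summit.HodgeConjecture.HodgeConjecture.Theorems.WeilTwelvefoldsSqrtMinus7.IsotypicUnimodularSaturation
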